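import Summits.ABC.ABC.Theorems.DefiniteXiFreyModularityStubAbsIrrNegThree
import Literature.NumberTheory.PAdicHodge.FontaineDpst
import Literature.NumberTheory.GaloisRepresentations.CalegariEvenFontaineMazurTwo
import Literature.NumberTheory.EllipticCurves.FramedTateGaloisRep
import Literature.NumberTheory.Automorphic.CDTTheorem722
import HarnessLib

/-!
# Stub ideas, k = 3 (FAMILY 3 — probe the extremes), generation 11, for `stub_liftThree`
# (crux `FreyModularity`, route `DefiniteXi`, item `stmt-ABC-11340`)

Companion to `STUB-IDEAS-stub_liftThree-3.md` (gen 11).  The registered stub (VERBATIM,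
`Lines/Sketch.lean:157`) is `LiftThree` below: Wiles–Taylor–Wiles–Diamond `R = T` at `ℓ = 3` on
`{9 ∤ N}` (Diamond 1996, Thm. 5.3; CDT 1999, Thm. 7.2.1 ∩ {9 ∤ N}).

What is NEW here relative to gens 1–10 (all three lanes):

* **E-split sharpened (H0, H0′, PROVED).**  In the flat cell (α) = {good supersingular at `3`} the
  stub's global hypothesis `hirr : ρ̄|_{ℚ(√-3)} abs. irreducible` is FREE (Serre's Prop. 12 c):
  inertia at `3` contains an element of order `8`), so the gen-2 regime split
  `LiftThreeSupersingular ∧ LiftThreeOrdinary → LiftThree` loses a hypothesis on its flat half: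
  `liftThree_of_flat_of_ordinary`.  Extremal reading: the two "hard" inputs of the stub never bind
  in the same cell — (α): global irreducibility automatic, local condition = FLAT (finite flat /
  Barsotti–Tate, Conrad 1997 Thm. 1.2, Ramakrishna Thm. 3.5); (β, γ): local condition = ORDINARY
  (k3 gen-9 M-chain, PROVED), global irreducibility load-bearing.
* **Gen-7's D1 ("the flat lift condition has no tree predicate") is OBSOLETE.**  The tree now
  carries Kisin's vocabulary: `PstWeilDeligneData.IsCrystallineFramed`, `IsDeRhamWithWeightsIn`,
  the pinned datum `fontainePstAdicCompletion v p hv`, the interface `CrystallineDeformationRing`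
  (= `PointwiseLiftingRing` cut out by "crystalline ∧ H"), Kisin's existence / generic-fibre
  regularity as clauses (F5)–(F7) of `IsFontaineDatum` (`fontainePst_kisin`,
  `isFontaineDatum_fontainePstAdicCompletion`).  Cell (α)'s local deformation condition at `3` is
  therefore TYPED: crystalline with Hodge–Tate weights in `[-1, 0]` (tree convention
  `HT(ε) = {-1}`, `PstWeilDeligneCyclotomicPowersWeights`; `V_p E` has weights `{-1, 0}`, its dual
  `H¹` has `{0, 1}`) — H1 (named-fact shape), H4 (PROVED from hypotheses), H4′ (ABC instance).
* **H5** types the frame compatibility "`ρ_{E,ℓ}` framed reduces to any framed model of `E[ℓ]`"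
  in the EXISTING vocabulary `FramedGaloisRep.IsReductionOf` (no such lemma in the tree; generic
  `ℓ`, bankable).

Sorries: ONLY in the offered helpers H1, H5 (new named-fact / Literature-lemma shapes).
-/

noncomputable section

open scoped MatrixGroups NumberField
open Matrix Field NumberField IsDedekindDomain IsDedekindDomain.HeightOneSpectrum IsLocalRing
open Literature.NumberTheory.EllipticCurves
open Literature.NumberTheory.Automorphic Literature.NumberTheory.Automorphic.BCDT
open Literature.NumberTheory.GaloisRepresentations
open Literature.NumberTheory.GaloisRepresentations.ModPGaloisRep
open Literature.NumberTheory.PAdicHodge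
open WeierstrassCurve

namespace Summit.ABC.ABC.Cruxes.FreyModularity.StubIdeas3G11

open Summit.ABC.ABC.Theorems

/-! ## The stub, verbatim -/

/-- The registered signature of `stub_liftThree` (VERBATIM, `Lines/Sketch.lean:157`).
[cite: Diamond1996, Thm. 5.3] [cite: ConradDiamondTaylor1999, Thm. 7.2.1] -/
def LiftThree : Prop :=
  ∀ (W : WeierstrassCurve ℚ) [W.IsElliptic] (ρ : ModPGaloisRep ℚ (ZMod 3) 2),
    W.IsTorsionGaloisRep 3 ρ → ρ.IsAbsIrreducibleOverSqrt (-3) → ¬ 9 ∣ W.conductorNorm ℤ →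
      ρ.IsModular → W.IsModularGaloisRepTate 3

/-! ## H0 — in the flat cell (α) the hypothesis `hirr` is free (PROVED) -/

/-- **H0 (PROVED, S).**  For `E/ℚ` globally minimal with `3 ∤ Δ_E` and `3 ∣ a₃(E)` (good
supersingular reduction at `3`) and ANY framed model `ρ̄` of `E[3]`, `ρ̄|_{ℚ(√-3)}` is absolutely
irreducible: inertia at `3` acts through a non-split Cartan subgroup, cyclic of order `8`
(`exists_orderOf_eq_eight_of_dvd_frobeniusTrace`, Serre 1972 Prop. 12 c)), `det ρ̄ = χ̄₃`
(Weil pairing), and an element of order `8` forces absolute irreducibility on `ker χ̄₃`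
(`isAbsIrreducibleOverSqrt_negThree_of_orderOf_eq_eight`).  The Frey-only version
`isAbsIrreducibleOverSqrt_negThree_freyCurve_of_not_three_dvd` is landed; this is the general-`W`
form the cell decomposition of `stub_liftThree` wants.
[cite: Serre1972, §1.11 Prop. 12 c)] [cite: Conrad1997Flat, Thm. 1.1] -/
theorem isAbsIrreducibleOverSqrt_negThree_of_dvd_frobeniusTrace (W : WeierstrassCurve ℚ)
    [W.IsGloballyMinimal] [W.IsElliptic] (hΔ : ¬ ((3 : ℕ) : ℤ) ∣ minimalDiscriminantInt W)
    (hss : ((3 : ℕ) : ℤ) ∣ W.frobeniusTrace 3) {ρ : ModPGaloisRep ℚ (ZMod 3) 2}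
    (hρ : W.IsTorsionGaloisRep 3 ρ) : ρ.IsAbsIrreducibleOverSqrt (-3) := by
  have hdet := W.det_eq_modPCyclotomicCharacter_of_isTorsionGaloisRep_holds 3 ρ hρ
  obtain ⟨σ, hσ⟩ := exists_orderOf_eq_eight_of_dvd_frobeniusTrace W hΔ hss hρ
  exact isAbsIrreducibleOverSqrt_negThree_of_orderOf_eq_eight ρ hdet hσ

/-- A framed model of `E[n]` is a framed model of `E'[n]` for a bijective isogeny `E → E'` (copy
of the private `isTorsionGaloisRep_of_isogeny_bijective'` of `…StubAbsIrrNegThree`; the public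
`isTorsionGaloisRep_of_isogeny_bijective` lives in `…StubAbsIrrSqrtFiveLocal`, not imported here to
keep the closure on the farm snapshot). [folklore] -/
private theorem isTorsionGaloisRep_of_isogeny_bijective'' {K : Type*} [Field K]
    {W W' : WeierstrassCurve K} (κ : Isogeny W W') (hκ : Function.Bijective κ) {n : ℕ}
    {ρ : FramedGaloisRep K (ZMod n) 2} (h : W.IsTorsionGaloisRep n ρ) :
    W'.IsTorsionGaloisRep n ρ := by
  -- adapted from `Summit.ABC.ABC.Theorems.isTorsionGaloisRep_of_isogeny_bijective`
  have hmem : ∀ P : geomTorsion W n, κ (P : W.geomPoints) ∈ geomTorsion W' n := fun P ↦ by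
    have hP : (n : ℤ) • (P : W.geomPoints) = 0 := (Submodule.mem_torsionBy_iff (n : ℤ) _).mp P.2
    refine (Submodule.mem_torsionBy_iff (n : ℤ) _).mpr ?_
    rw [← map_zsmul, hP, map_zero]
  let f : geomTorsion W n → geomTorsion W' n := fun P ↦ ⟨κ (P : W.geomPoints), hmem P⟩
  have hf : Function.Bijective f := by
    constructor
    · intro P Q hPQ
      exact Subtype.ext (hκ.1 (congrArg Subtype.val hPQ))
    · intro Q
      obtain ⟨P, hP⟩ := hκ.2 (Q : W'.geomPoints)
      have hPn : P ∈ geomTorsion W n := by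
        refine (Submodule.mem_torsionBy_iff (n : ℤ) _).mpr (hκ.1 ?_)
        have hQ : (n : ℤ) • (Q : W'.geomPoints) = 0 :=
          (Submodule.mem_torsionBy_iff (n : ℤ) _).mp Q.2
        rw [map_zsmul, hP, hQ, map_zero]
      exact ⟨⟨P, hPn⟩, Subtype.ext hP⟩
  let f' : geomTorsion W n →+ geomTorsion W' n :=
    { toFun := f
      map_zero' := Subtype.ext (map_zero κ)
      map_add' := fun P Q ↦ Subtype.ext (map_add κ (P : W.geomPoints) (Q : W.geomPoints)) }
  let ε : geomTorsion W n ≃+ geomTorsion W' n := AddEquiv.ofBijective f' hf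
  have hε : ∀ P : geomTorsion W n,
      ((ε P : geomTorsion W' n) : W'.geomPoints) = κ (P : W.geomPoints) := fun P ↦ rfl
  have hεsmul : ∀ (σ : absoluteGaloisGroup K) (P : geomTorsion W n), ε (σ • P) = σ • ε P := by
    intro σ P
    apply Subtype.ext
    rw [hε, AddSubgroup.torsionBy.coe_smul, κ.map_smul, AddSubgroup.torsionBy.coe_smul, hε]
  obtain ⟨e, he⟩ := h
  refine ⟨ε.symm.trans e, fun σ Q ↦ ?_⟩
  have hQ : ε.symm (σ • Q) = σ • ε.symm Q := by
    apply ε.injective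
    rw [AddEquiv.apply_symm_apply, hεsmul, AddEquiv.apply_symm_apply]
  rw [AddEquiv.trans_apply, AddEquiv.trans_apply, hQ, he]

/-- **H0′ (PROVED, S) — model-free form in the stub's vocabulary.**  For an elliptic `W/ℚ` with
good reduction at `3` and `3 ∣ a₃ = L(W)_3` (the gen-2 cell condition
`W.HasGoodReductionAtPrime 3 ∧ 3 ∣ W.LFunction 3`), every framed model of `W[3]` is absolutely
irreducible over `ℚ(√-3)`.  Read on a global minimal model `C • W`
(`hasGlobalMinimalModel_rat_holds`; same `3`-torsion module, same `L`-function).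
[cite: Serre1972, §1.11 Prop. 12 c)] [cite: Conrad1997Flat, Thm. 1.1] -/
theorem isAbsIrreducibleOverSqrt_negThree_of_supersingular (W : WeierstrassCurve ℚ) [W.IsElliptic]
    (hgood : W.HasGoodReductionAtPrime 3) (hss : (3 : ℤ) ∣ W.LFunction 3)
    {ρ : ModPGaloisRep ℚ (ZMod 3) 2} (hρ : W.IsTorsionGaloisRep 3 ρ) :
    ρ.IsAbsIrreducibleOverSqrt (-3) := by
  haveI : Fact (Nat.Prime 3) := ⟨Nat.prime_three⟩
  obtain ⟨C, hC⟩ := hasGlobalMinimalModel_rat_holds W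
  haveI := hC
  set v : HeightOneSpectrum (𝓞 ℚ) :=
    (Rat.HeightOneSpectrum.primesEquiv (R := 𝓞 ℚ)).symm ⟨3, Nat.prime_three⟩ with hv
  have hv3 : (Rat.HeightOneSpectrum.primesEquiv v : ℕ) = 3 := by
    rw [hv, Equiv.apply_symm_apply]
  have hgood' : (C • W).HasGoodReductionAtPrime 3 := by
    rw [hasGoodReductionAtPrime_primesEquiv_iff_holds (C • W) v 3 hv3,
      hasGoodReductionAt_smul_iff_holds v W C]
    exact (hasGoodReductionAtPrime_primesEquiv_iff_holds W v 3 hv3).mp hgood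
  have hΔ := (C • W).not_dvd_minimalDiscriminantInt_of_hasGoodReductionAtPrime' 3 hgood'
  have hρ' : (C • W).IsTorsionGaloisRep 3 ρ :=
    isTorsionGaloisRep_of_isogeny_bijective'' (VariableChange.toIsogeny W C)
      ⟨VariableChange.toIsogeny_injective W C, VariableChange.toIsogeny_surjective W C⟩ hρ
  have hss' : ((3 : ℕ) : ℤ) ∣ (C • W).frobeniusTrace 3 := by
    have h := LFunction_apply_prime_eq_frobeniusTrace (C • W) 3 hgood'
    rw [LFunction_smul] at h
    rw [← h]
    exact_mod_cast hss
  exact isAbsIrreducibleOverSqrt_negThree_of_dvd_frobeniusTrace (C • W) hΔ hss' hρ'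

/-! ## The sharpened E-split of the stub (PROVED glue) -/

/-- **Cell (α), flat** — NO `hirr` hypothesis (free by H0′), no `h9` (good at `3`): Wiles' flat
case of `R = T` at `3` (Conrad 1997 Thm. 1.2: `E[3ⁿ]` finite flat over `ℤ₃`; Ramakrishna Thm. 3.5:
`R^fl ≅ 𝒪⟦T₁, T₂⟧`). [cite: Conrad1997Flat, Thm. 1.2 and Thm. 3.5] [cite: Diamond1996, Thm. 5.3] -/
def LiftThreeFlat : Prop :=
  ∀ (W : WeierstrassCurve ℚ) [W.IsElliptic] (ρ : ModPGaloisRep ℚ (ZMod 3) 2),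
    W.IsTorsionGaloisRep 3 ρ → W.HasGoodReductionAtPrime 3 → (3 : ℤ) ∣ W.LFunction 3 →
      ρ.IsModular → W.IsModularGaloisRepTate 3

/-- **Cells (β) ∪ (γ), ordinary** (multiplicative, resp. good ordinary at `3`; gen-2
`LiftThreeOrdinary` verbatim): Wiles' Selmer/ordinary case; the local ordinary line at `3` is the
k3 gen-9 M-chain (PROVED) resp. `ellipticOrdinaryReduction_tateModule_filtration_holds`.
[cite: Diamond1996, Thm. 5.3] [cite: Wiles1995, Thm. 0.2] -/
def LiftThreeOrdinary : Prop :=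
  ∀ (W : WeierstrassCurve ℚ) [W.IsElliptic] (ρ : ModPGaloisRep ℚ (ZMod 3) 2),
    W.IsTorsionGaloisRep 3 ρ → ρ.IsAbsIrreducibleOverSqrt (-3) → ¬ 9 ∣ W.conductorNorm ℤ →
      ¬ (W.HasGoodReductionAtPrime 3 ∧ (3 : ℤ) ∣ W.LFunction 3) → ρ.IsModular →
        W.IsModularGaloisRepTate 3

/-- **Glue (PROVED): the flat cell without `hirr` and the ordinary cells cover the stub.**
[cite: Diamond1996, Thm. 5.3] -/
theorem liftThree_of_flat_of_ordinary (hfl : LiftThreeFlat) (hord : LiftThreeOrdinary) :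
    LiftThree := by
  intro W _ ρ hρ hirr h9 hmod
  by_cases h : W.HasGoodReductionAtPrime 3 ∧ (3 : ℤ) ∣ W.LFunction 3
  · exact hfl W ρ hρ h.1 h.2 hmod
  · exact hord W ρ hρ hirr h9 h hmod

/-- Sanity (PROVED): in cell (α) the stub's `hirr` is implied by the other hypotheses, so nothing
is lost by dropping it from `LiftThreeFlat`. [cite: Serre1972, §1.11 Prop. 12 c)] -/
theorem hirr_redundant_in_flat_cell (W : WeierstrassCurve ℚ) [W.IsElliptic]
    (ρ : ModPGaloisRep ℚ (ZMod 3) 2) (hρ : W.IsTorsionGaloisRep 3 ρ)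
    (h : W.HasGoodReductionAtPrime 3 ∧ (3 : ℤ) ∣ W.LFunction 3) :
    ρ.IsAbsIrreducibleOverSqrt (-3) :=
  isAbsIrreducibleOverSqrt_negThree_of_supersingular W h.1 h.2 hρ

/-! ## H1 — `V_p E` at a place of good reduction is crystalline with weights `[-1, 0]`
(named-fact shape over the tree's Kisin vocabulary; generic number field and prime) -/

/-- **H1 (NEW named-fact shape, Literature level; sorry = the fact).**  For an elliptic curve `E`
over a number field `K`, a prime `p`, a place `v ∣ p` of GOOD reduction: the local framed
representation `ρ_{E,p}|_{Γ_{K_v}}` (`(W.framedTateGaloisRep p).toLocal v`, a frame of `V_p E`) is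
crystalline for THE `p`-adic Hodge datum `fontainePstAdicCompletion v p hv` and de Rham with
Hodge–Tate weights in `[-1, 0]` (tree convention `HT(ε) = {-1}`: `V_p E ≅ (H¹_ét)^∨` has weights
`{-1, 0}`).  Sources: `E[pⁿ]` extends to a finite flat group scheme over `𝒪_v` for all `n` (the
`pⁿ`-torsion of the Néron model; Conrad 1997 Thm. 1.2), so `T_p E` is the Tate module of the
`p`-divisible group of an abelian scheme, crystalline with weights in `{0, -1}` (Fontaine;
Faltings 1989; Tsuji 1999 `C_st` ⊇ `C_cris` for `H¹`).  Frame-independent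
(`PstWeilDeligneData.isCrystallineFramed_conj_iff`).  Not among the clauses (F1)–(F14) of
`IsFontaineDatum`; candidate clause / D-0014 named fact.
[cite: Conrad1997Flat, Thm. 1.2] [cite: Faltings1989Crystalline, §5] [cite: Tsuji1999Cst, Thm. 0.2] -/
theorem isCrystallineFramed_toLocal_framedTateGaloisRep_of_hasGoodReductionAt
    {K : Type} [Field K] [NumberField K] (W : WeierstrassCurve K) [W.IsElliptic]
    (p : ℕ) [Fact p.Prime] (v : HeightOneSpectrum (𝓞 K)) (hv : ((p : ℕ) : 𝓞 K) ∈ v.asIdeal)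
    (hgood : W.HasGoodReductionAt v) :
    (fontainePstAdicCompletion v p hv).IsCrystallineFramed ((W.framedTateGaloisRep p).toLocal v) ∧
      (fontainePstAdicCompletion v p hv).IsDeRhamWithWeightsIn (-1) 0
        ((W.framedTateGaloisRep p).toLocal v) := by
  sorry

/-! ## H4 — the flat cell's local deformation ring at `v ∣ p` EXISTS as a
`CrystallineDeformationRing … (IsDeRhamWithWeightsIn (-1) 0)` (PROVED from hypotheses) -/

/-- **H4 (PROVED glue, generic).**  If THE datum at `v ∣ p` has Kisin's interval-form rings
(clause (F5), `IsFontaineDatum.hasCrystallineDeformationRings`) and a global framed `ρ` is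
crystalline with weights in `[-1, 0]` at `v`, then for every finite `L/ℚ_p ⊆ ℚ̄_p` and every
residual `ρ̄_v : Γ_{K_v} → GL_n(k_L)` to which `ρ|_{Γ_{K_v}}` reduces through `𝒪_L`, Kisin's
crystalline deformation ring `R^□,[-1,0]-cris_{𝒪_L, ρ̄_v}` exists (is `Nonempty`) — `ρ|_{Γ_{K_v}}`
is one of its `ℚ̄_p`-points (`existsUnique_point`).  This is the typed seat of the FLAT local
condition of `stub_liftThree`, cell (α) (and of the crystalline-ordinary cell (γ)).
[cite: Kisin2007, Introduction, Thm. 2.5.5 and Cor. 2.7.7] [cite: BarnetlambEtAl2014, §1.4] -/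
theorem nonempty_crystallineDeformationRing_of_isCrystallineFramed_toLocal
    {K : Type} [Field K] [NumberField K] {n : ℕ} (p : ℕ) [Fact p.Prime]
    (v : HeightOneSpectrum (𝓞 K)) (hv : ((p : ℕ) : 𝓞 K) ∈ v.asIdeal)
    (hK : (fontainePstAdicCompletion v p hv).HasCrystallineDeformationRings)
    (ρ : FramedGaloisRep K (PadicAlgCl p) n)
    (hcr : (fontainePstAdicCompletion v p hv).IsCrystallineFramed (ρ.toLocal v))
    (hwt : (fontainePstAdicCompletion v p hv).IsDeRhamWithWeightsIn (-1) 0 (ρ.toLocal v))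
    (L : IntermediateField ℚ_[p] (PadicAlgCl p)) [FiniteDimensional ℚ_[p] L] :
    letI := intermediateFieldIntegers.algebraPadicAlgCl L
    letI : TopologicalSpace (ResidueField (intermediateFieldIntegers p L)) := ⊥
    ∀ ρbarv : FramedRep (absoluteGaloisGroup (v.adicCompletion K))
        (ResidueField (intermediateFieldIntegers p L)) n,
      ReducesTo (intermediateFieldIntegers p L) (ρ.toLocal v).toMonoidHom ρbarv.toMonoidHom →
        Nonempty (CrystallineDeformationRing p (v.adicCompletion K) (intermediateFieldIntegers p L)
          (ResidueField (intermediateFieldIntegers p L)) ρbarv (fontainePstAdicCompletion v p hv)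
          ((fontainePstAdicCompletion v p hv).IsDeRhamWithWeightsIn (-1) 0)) := by
  letI := intermediateFieldIntegers.algebraPadicAlgCl L
  letI : TopologicalSpace (ResidueField (intermediateFieldIntegers p L)) := ⊥
  intro ρbarv hred
  exact hK L n ρbarv (-1) 0 ⟨ρ.toLocal v, hred, hcr, hwt⟩

/-- **H4′ (PROVED modulo H1; the ABC instance at `p = 3`).**  Under the T0 fact
`FontaineDatumExists` (which carries Kisin's (F5) for THE datum), for an elliptic `W/ℚ` with good
reduction at the place `v` over `3` — cells (α) and (γ) of `stub_liftThree` — and any residual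
frame `ρ̄_v` of `ρ_{W,3}|_{Γ_{ℚ₃}}` over `k_L`, the crystalline `[-1,0]` deformation ring of `ρ̄_v`
exists and `ρ_{W,3}|_{Γ_{ℚ₃}}` is a point of it.  (Uses H1 as a hypothesis `hH1`.)
[cite: Kisin2007, Cor. 2.7.7] [cite: Conrad1997Flat, Thm. 1.2 and Thm. 3.5] -/
theorem nonempty_crystallineDeformationRing_three_of_hasGoodReductionAt
    (h₀ : FontaineDatumExists) (W : WeierstrassCurve ℚ) [W.IsElliptic]
    (v : HeightOneSpectrum (𝓞 ℚ)) (hv : ((3 : ℕ) : 𝓞 ℚ) ∈ v.asIdeal)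
    (hH1 : (fontainePstAdicCompletion v 3 hv).IsCrystallineFramed
        ((W.framedTateGaloisRep 3).toLocal v) ∧
      (fontainePstAdicCompletion v 3 hv).IsDeRhamWithWeightsIn (-1) 0
        ((W.framedTateGaloisRep 3).toLocal v))
    (L : IntermediateField ℚ_[3] (PadicAlgCl 3)) [FiniteDimensional ℚ_[3] L] :
    letI := intermediateFieldIntegers.algebraPadicAlgCl L
    letI : TopologicalSpace (ResidueField (intermediateFieldIntegers 3 L)) := ⊥
    ∀ ρbarv : FramedRep (absoluteGaloisGroup (v.adicCompletion ℚ))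
        (ResidueField (intermediateFieldIntegers 3 L)) 2,
      ReducesTo (intermediateFieldIntegers 3 L) ((W.framedTateGaloisRep 3).toLocal v).toMonoidHom
          ρbarv.toMonoidHom →
        Nonempty (CrystallineDeformationRing 3 (v.adicCompletion ℚ) (intermediateFieldIntegers 3 L)
          (ResidueField (intermediateFieldIntegers 3 L)) ρbarv (fontainePstAdicCompletion v 3 hv)
          ((fontainePstAdicCompletion v 3 hv).IsDeRhamWithWeightsIn (-1) 0)) := by
  haveI := LocalField.charZero_adicCompletion v
  have hK : (fontainePstAdicCompletion v 3 hv).HasCrystallineDeformationRings :=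
    (isFontaineDatum_fontainePstAdicCompletion h₀ v 3 hv).hasCrystallineDeformationRings
  exact nonempty_crystallineDeformationRing_of_isCrystallineFramed_toLocal 3 v hv hK
    (W.framedTateGaloisRep 3) hH1.1 hH1.2 L

/-! ## H5 — frame compatibility: `ρ_{E,ℓ}` framed reduces to every framed model of `E[ℓ]`
(Literature-lemma shape, generic `ℓ`; EXISTING vocabulary `FramedGaloisRep.IsReductionOf`) -/

/-- **H5 (NEW Literature lemma shape, M; sorry).**  For an elliptic curve `E` over a number field
`K`, a prime `ℓ` and a framed model `ρ̄ : Γ_K → GL₂(ℤ/ℓ)` of `E[ℓ]` (`IsTorsionGaloisRep`), the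
framed `ℓ`-adic representation `ρ_{E,ℓ} : Γ_K → GL₂(ℚ̄_ℓ)` (`framedTateGaloisRep`, a frame of
`V_ℓ E = T_ℓ E ⊗ ℚ_ℓ`) has `ρ̄` (pushed into `ℤ̄_ℓ/𝔪` along `ℤ/ℓ → ℤ̄_ℓ/𝔪`) as a reduction: `T_ℓ E` is
a `Γ_K`-stable `ℤ_ℓ`-lattice (an integral model after conjugating the `ℚ_ℓ`-basis into a
`ℤ_ℓ`-basis, `IsIntegralModelOf`) and `T_ℓ E/ℓ ≅ E[ℓ]` (Silverman III.7), the two frames of `E[ℓ]`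
differing by a `GL₂`-conjugation (`Q` in `IsReductionOf`).  With H4′ this makes
`ρ_{W,3}|_{Γ_{ℚ₃}}` a point of the crystalline `[-1,0]` ring of (a conjugate-and-extend-scalars of)
the stub's OWN `ρ̄|_{Γ_{ℚ₃}}` — the remaining bridge `IsReductionOf → ReducesTo 𝒪_L (conj P ρ) _`
is bookkeeping (pattern `reducesTo_one_one`).
[cite: SilvermanAEC2009, Prop. III.7.1 and Remark III.7.2] [cite: DarmonDiamondTaylor1995, §2.1, p. 54] -/
theorem isReductionOf_framedTateGaloisRep_of_isTorsionGaloisRep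
    {K : Type} [Field K] [NumberField K] (W : WeierstrassCurve K) [W.IsElliptic]
    (ℓ : ℕ) [Fact ℓ.Prime] (ρbar : ModPGaloisRep K (ZMod ℓ) 2) (hρ : W.IsTorsionGaloisRep ℓ ρbar) :
    (W.framedTateGaloisRep ℓ).IsReductionOf (RingHom.id _)
      ((Matrix.GeneralLinearGroup.map (zmodToPadicAlgClResidueField ℓ)).comp ρbar.toMonoidHom) := by
  sorry

/-! ## H6 / D1′ — cell (β): the multiplicative cell's local condition is typeable too
(semistable, `N ≠ 0`, weights `[-1, 0]`), from the fields of `PstWeilDeligneData` -/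

section Semistable

variable {F : Type} [Field F] [ValuativeRel F] [TopologicalSpace F] [IsNonarchimedeanLocalField F]
  {ℓ : ℕ} [Fact ℓ.Prime]

/-- **D1′ (definition-request shape, one line over existing fields).**  `ρ : Γ_F → GL_n(ℚ̄_ℓ)` is
SEMISTABLE NON-CRYSTALLINE relative to the datum `𝔇`: de Rham, Weil–Deligne representation with
unramified Weil part and `N ≠ 0` (compare `PstWeilDeligneData.IsCrystallineFramed`: same with
`N = 0`).  The tree has no semistable / ordinary framed predicate over `𝔇` (only crystalline and
`IsPotentiallyCrystallineFn`); this is the shape cell (β) of `stub_liftThree` needs if it is to be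
seated in Kisin's vocabulary (Kisin 2008 (2.6), Thm. (2.7.6): `R^{□,ψ}_{V_𝔽}(τ, v)` potentially
semistable rings). [cite: FontaineAsterisque223VIII, §1.3 and §2.3.7] [cite: Kisin2007, Thm. 2.7.6] -/
def IsSemistableNonCrystallineFramed (𝔇 : PstWeilDeligneData F ℓ) {n : ℕ}
    (ρ : FramedRep (absoluteGaloisGroup F) (PadicAlgCl ℓ) n) : Prop :=
  𝔇.IsDeRhamFramed ρ ∧ ∃ r, 𝔇.IsWeilDeligneOf ρ r ∧ WeilGroup.IsUnramifiedRep r.ρ ∧ r.N ≠ 0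

end Semistable

/-- **H6 (NEW named-fact shape; sorry = the fact).**  At a place `v ∣ p` of MULTIPLICATIVE
reduction, `ρ_{E,p}|_{Γ_{K_v}}` is semistable non-crystalline with Hodge–Tate weights in `[-1, 0]`:
by Tate's uniformisation `V_p E|_{Γ_{K_v}} ≅ δ ⊗ (0 → ℚ_p(1) → V_p E_q → ℚ_p → 0)` with `δ`
unramified quadratic, and `V_p E_q` is the standard semistable non-crystalline extension
(`N ≠ 0`; Fontaine 1994, Exp. VIII; Conrad 1997 Thm. 1.1 for the shape).  This is cell (β) of
`stub_liftThree` (where Wiles' local condition is ORDINARY — k3 gen-9 M-chain — not flat).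
[cite: Conrad1997Flat, Thm. 1.1] [cite: FontaineAsterisque223VIII, §2.3.7] [cite: SilvermanATAEC1994, Thm. V.5.3] -/
theorem isSemistableNonCrystallineFramed_toLocal_of_hasMultiplicativeReductionAt
    {K : Type} [Field K] [NumberField K] (W : WeierstrassCurve K) [W.IsElliptic]
    (p : ℕ) [Fact p.Prime] (v : HeightOneSpectrum (𝓞 K)) (hv : ((p : ℕ) : 𝓞 K) ∈ v.asIdeal)
    (hmult : W.HasMultiplicativeReductionAt v) :
    IsSemistableNonCrystallineFramed (fontainePstAdicCompletion v p hv)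
        ((W.framedTateGaloisRep p).toLocal v) ∧
      (fontainePstAdicCompletion v p hv).IsDeRhamWithWeightsIn (-1) 0
        ((W.framedTateGaloisRep p).toLocal v) := by
  sorry

end Summit.ABC.ABC.Cruxes.FreyModularity.StubIdeas3G11

end
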